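import Summits.NavierStokesRegularity.NavierStokesRegularity.Theses.PerpetualPump
import Literature.Analysis.FluidPDE.TaoAveragedSobolevProofs
import Literature.Analysis.FluidPDE.TaoMildSolutionBounds

/-!
# Crux `AveragedTypeIBlowup` (stmt-NavierStokesRegularity-1835), negative side: the Navier–Stokes reduction

Negative-side (cdisprove, D-0016) support lemmas extracted from
`Cruxes/AveragedTypeIBlowup/Disproof.lean` (v1, §§1–3) so that ideators / planners / provers can
IMPORT them. Nothing here closes the item (`--supports`); no statement of the route is changed.

* `averagedTypeIBlowup_iff_not_thesis` — the crux is literally `¬ Thesis` (classical logic).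
* `not_nsTypeIBlowup_of_not_averagedTypeIBlowup` — WHY THE CRUX RESISTS DISPROOF: Tao's
  class contains the Navier–Stokes bilinear operator itself (`AveragingDatum.euler`, accepted
  `euler_form`, `euler_isSymmetric`, `euler_hasCancellation`), so any disproof of the crux proves
  forward Type-I exclusion for the true 3-D Navier–Stokes equations (`ν = 1`, Tao (1.5)) in the
  `H¹⁰_df`-mild class from Schwartz data (`nsTypeI_extends_of_not_averagedTypeIBlowup` is the
  same fact as a continuation statement) — an open problem (KNSS 2009 §1: (L) would exclude Type I; in tree
  `Literature.Analysis.FluidPDE.LiouvilleConjectureNS` is a `@[conjecture]`; Cheskidov–Dai–Palasek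
  2025 §1.3, quoted in `Literature.Barriers.NavierStokesRegularity.InstantaneousTypeIBlowup`:
  finite-time Type-I blow-up for `d ≥ 3` "is a major open question"). Through the route's glue item
  `EulerTypeIGlue` (stmt-1838) it reaches the classical statement
  (`noTypeIClassical_of_not_averagedTypeIBlowup`).
* `extension_H10_bounded` / `no_extension_of_H10_unbounded` — the non-extension conjunct of the
  crux in the form a prover discharges it: a mild extension past `T` is `H¹⁰`-continuous at `T`,
  hence `sup_{t<T} ‖u(t)‖_{H¹⁰} = ∞` forbids every extension (no uniqueness theory needed).

## References

* T. Tao, J. Amer. Math. Soc. 29 (2016), arXiv:1402.0290v3, §1.1 (1.2), (1.13), (1.15), p. 7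
  (local `H¹⁰` theory), p. 8 + footnote (Type I vs Type II; whether [ESS] extends is open).
  [`Tao2016AveragedNS`]
* G. Koch, N. Nadirashvili, G. Seregin, V. Šverák, Acta Math. 203 (2009), §1.
  [`KochNadirashviliSereginSverak2009`]
-/

noncomputable section

namespace Summit.NavierStokesRegularity.NavierStokesRegularity.Theorems.AveragedTypeIBlowup.Negative

open MeasureTheory Set Filter Topology
open scoped ENNReal
open Literature.Analysis.FluidPDE Literature.Analysis.FluidPDE.Tao2016
open Literature.Analysis.FluidPDE.Tao2016.AveragingDatum
open Summit.NavierStokesRegularity.NavierStokesRegularity.Theses.PerpetualPump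

/-! ## The crux is the negation of the route target -/

/-- `AveragedTypeIBlowup ↔ ¬ Thesis`: the crux is the classical negation of the route's target
(abstract Type-I exclusion over Tao's averaging class). [folklore] -/
theorem averagedTypeIBlowup_iff_not_thesis : AveragedTypeIBlowup ↔ ¬ Thesis := by
  unfold AveragedTypeIBlowup Thesis
  constructor
  · rintro ⟨𝒜, hs, hc, u₀, hdiv, T, hT, u, hmild, hrate, hno⟩ h
    exact hno (h 𝒜 hs hc u₀ hdiv T hT u hmild hrate)
  · intro h
    by_contra hcon
    apply h
    intro 𝒜 hs hc u₀ hdiv T hT u hmild hrate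
    by_contra hext
    exact hcon ⟨𝒜, hs, hc, u₀, hdiv, T, hT, u, hmild, hrate, hext⟩

/-! ## The Navier–Stokes reduction -/

/-- **Why the crux resists disproof.** A disproof of `AveragedTypeIBlowup` excludes forward Type-I
blow-up for the Navier–Stokes equations themselves in Tao's `H¹⁰_df`-mild class — there is then
no Schwartz divergence-free datum, time `T > 0` and `H¹⁰_df`-mild solution of
`∂ₜu = Δu + B(u,u)` (`ν = 1`, Tao (1.5); the Euler datum `AveragingDatum.euler` has `B̃ = B`,
`euler_form`) on `[0,T)` at the Type-I rate `‖u(t)‖_∞ ≤ M (T-t)^{-1/2}` without mild extension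
past `T` — because the Euler datum is a symmetric averaging datum with cancellation
(`euler_isSymmetric`, `euler_hasCancellation`). The conclusion is the open Type-I exclusion
problem (KNSS 2009, §1). [cite: KochNadirashviliSereginSverak2009, §1] -/
theorem not_nsTypeIBlowup_of_not_averagedTypeIBlowup (h : ¬ AveragedTypeIBlowup) :
    ¬ ∃ u₀ : SchwartzMap (EuclideanSpace ℝ (Fin 3)) (EuclideanSpace ℝ (Fin 3)),
        VectorCalculus.IsDivFree ⇑u₀ ∧ ∃ T : ℝ, 0 < T ∧ ∃ u : ℝ → L2C,
        AveragingDatum.euler.IsMildSolution (schwartzL2 u₀) (Ico 0 T) u ∧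
        (∃ M : ℝ, ∀ t ∈ Ico 0 T, eLpNorm (u t) ⊤ volume ≤ ENNReal.ofReal (M / Real.sqrt (T - t))) ∧
        ¬ ∃ T' : ℝ, T < T' ∧ ∃ v : ℝ → L2C,
          AveragingDatum.euler.IsMildSolution (schwartzL2 u₀) (Ico 0 T') v ∧
            ∀ t ∈ Ico 0 T, v t = u t :=
  fun hb => h ⟨AveragingDatum.euler, euler_isSymmetric, euler_hasCancellation, hb⟩

/-- The same reduction as a continuation statement: if the crux fails, every `H¹⁰_df`-mild
Navier–Stokes solution (`ν = 1`) from Schwartz divergence-free data obeying the Type-I rate on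
`[0,T)` extends as a mild solution past `T`. [cite: KochNadirashviliSereginSverak2009, §1] -/
theorem nsTypeI_extends_of_not_averagedTypeIBlowup (h : ¬ AveragedTypeIBlowup)
    (u₀ : SchwartzMap (EuclideanSpace ℝ (Fin 3)) (EuclideanSpace ℝ (Fin 3)))
    (hdiv : VectorCalculus.IsDivFree ⇑u₀) (T : ℝ) (hT : 0 < T) (u : ℝ → L2C)
    (hmild : AveragingDatum.euler.IsMildSolution (schwartzL2 u₀) (Ico 0 T) u)
    (hrate : ∃ M : ℝ, ∀ t ∈ Ico 0 T, eLpNorm (u t) ⊤ volume ≤ ENNReal.ofReal (M / Real.sqrt (T - t))) :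
    ∃ T' : ℝ, T < T' ∧ ∃ v : ℝ → L2C,
      AveragingDatum.euler.IsMildSolution (schwartzL2 u₀) (Ico 0 T') v ∧ ∀ t ∈ Ico 0 T, v t = u t := by
  by_contra hext
  exact not_nsTypeIBlowup_of_not_averagedTypeIBlowup h ⟨u₀, hdiv, T, hT, u, hmild, hrate, hext⟩

/-- **Reduction to the classical statement through the route's glue item.** Granting
`EulerTypeIGlue` (stmt-NavierStokesRegularity-1838), a disproof of the crux proves: every
finite-energy classical Navier–Stokes solution on `[0,T)` from a rapidly decaying datum that blows
up at the Type-I rate (`IsTypeIBlowup`) extends smoothly past `T` — "no Type-I blow-up from Clay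
data", the open KNSS / Seregin–Šverák-tier statement. [cite: KochNadirashviliSereginSverak2009, §1] -/
theorem noTypeIClassical_of_not_averagedTypeIBlowup (hG : EulerTypeIGlue) (h : ¬ AveragedTypeIBlowup) :
    ∀ (ν T : ℝ), 0 < ν → 0 < T →
      ∀ (u : ℝ → EuclideanSpace ℝ (Fin 3) → EuclideanSpace ℝ (Fin 3))
        (p : ℝ → EuclideanSpace ℝ (Fin 3) → ℝ),
      IsClassicalNSSolutionOn (Ico 0 T) ν 0 u p → IsLerayHopfOn T ν 0 (u 0) u →
      HasRapidSpatialDecay (u 0) → IsTypeIBlowup u T → HasSmoothExtensionPast ν 0 u T :=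
  hG (Classical.not_not.mp (averagedTypeIBlowup_iff_not_thesis.not.mp h))

/-! ## The non-extension conjunct -/

/-- **A mild extension past `T` forces `H¹⁰`-boundedness up to `T`.** If `v` is a mild solution on
`[0,T')`, `T < T'`, agreeing with `u` on `[0,T)`, then `‖u(t)‖_{H¹⁰}` is bounded on `[0,T)`: the
real function `t ↦ ‖v(t)‖_{H¹⁰}` is continuous on `Ico 0 T'` hence bounded on the compact
`[0,T] ⊆ Ico 0 T'`. No uniqueness of mild solutions is used. [folklore] -/
theorem extension_H10_bounded {𝒜 : AveragingDatum} {a : L2C} {T T' : ℝ} (hTT' : T < T')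
    {u v : ℝ → L2C} (hv : 𝒜.IsMildSolution a (Ico 0 T') v) (huv : ∀ t ∈ Ico 0 T, v t = u t) :
    ∃ C : ℝ, ∀ t ∈ Ico 0 T,
      Literature.Analysis.FunctionSpaces.eFourierSobolevNorm 10 (u t) ≤ ENNReal.ofReal C := by
  have hv' : IsMildSolutionFor 𝒜.form a (Ico 0 T') v := hv
  have hfin : ∀ t ∈ Ico 0 T',
      Literature.Analysis.FunctionSpaces.eFourierSobolevNorm 10 (v t) < ∞ :=
    fun t ht => (hv'.1 t ht).1
  have hcont := hv'.2.1.continuousOn_toReal hfin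
  have hsub : Icc 0 T ⊆ Ico 0 T' := fun t ht => ⟨ht.1, ht.2.trans_lt hTT'⟩
  obtain ⟨C, hC⟩ := isCompact_Icc.exists_bound_of_continuousOn (hcont.mono hsub)
  refine ⟨C, fun t ht => ?_⟩
  have htI : t ∈ Icc 0 T := ⟨ht.1, ht.2.le⟩
  have h := hC t htI
  rw [Real.norm_eq_abs, abs_le] at h
  rw [← huv t ht, ← ENNReal.ofReal_toReal (hfin t (hsub htI)).ne]
  exact ENNReal.ofReal_le_ofReal h.2

/-- **Prover's form of the non-extension conjunct.** If the `H¹⁰` norm of `u` is unbounded on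
`[0,T)` then `u` has no mild extension past `T` (any averaging datum, any datum class `a`). [folklore] -/
theorem no_extension_of_H10_unbounded {𝒜 : AveragingDatum} {a : L2C} {T : ℝ} {u : ℝ → L2C}
    (hunb : ∀ C : ℝ, ∃ t ∈ Ico 0 T,
      ENNReal.ofReal C < Literature.Analysis.FunctionSpaces.eFourierSobolevNorm 10 (u t)) :
    ¬ ∃ T' : ℝ, T < T' ∧ ∃ v : ℝ → L2C, 𝒜.IsMildSolution a (Ico 0 T') v ∧ ∀ t ∈ Ico 0 T, v t = u t := by
  rintro ⟨T', hTT', v, hv, huv⟩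
  obtain ⟨C, hC⟩ := extension_H10_bounded hTT' hv huv
  obtain ⟨t, ht, hlt⟩ := hunb C
  exact absurd (hC t ht) (not_le.mpr hlt)

end Summit.NavierStokesRegularity.NavierStokesRegularity.Theorems.AveragedTypeIBlowup.Negative

end
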